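import Literature.MathematicalPhysics.QuantumManyBody.BoseGasSubcellCondensationDilute
import HarnessLib

/-!
# Crux `BECTangentRigidity.TangentTransfer` (stmt-AtomisticToContinuum-13033), line `registered`:
# STUB 1 `stub_mesoscopicFloorPinned` — the pinned mesoscopic floor

For every repulsive finite-range pair potential `v` (hard cores allowed) and every `M ≥ 1` there is
`ρ₀ > 0` such that for `0 < ρ < ρ₀`, at the `N`-independent scale `ℓ = M/√ρ`, eventually in `N`,
every `δ`-near-minimiser `Ψ` (`δ = 1`) of the Dirichlet energy in the box of side
`L = (N/ρ)^{1/3}` and every dyadic level `k` with `ℓ ≤ L/2^k < 2ℓ` satisfy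
`cohSum N L k Ψ ≥ 7N/8`: the `8^k` flat cell modes of side `L/2^k` carry at least `7/8` of the
particles.

Proof: the two cases of the Literature theorems
`Literature.MathematicalPhysics.QuantumManyBody.BoseGas.floor_of_scatteringLength_zero`
(zero scattering length: the sharp cell gap `key_inequality` and `E₀^D(N, L_N) = o(N)`) and
`….floor_of_scatteringLength_pos` (positive scattering length: LSSY's localization mechanism —
Lemma 5.2 in every well-occupied cell, the generalized Poincaré inequality Lemma 4.1 on every
sub-cell of every one-particle slice with the balls around the same-cell particles removed, the
cell method with a crowding penalty, and the Dyson upper bound — run cell by cell on the big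
Dirichlet box: `seven_eighths_le_sum_occupation` of `BoseGasSubcellCondensation.lean`), followed by
the identification `∑_q ⟨u_q, γ_Ψ u_q⟩ = cohSum N L k Ψ` of the sub-cell modes of side `L/2^k`
with the dyadic flat modes (`sum_occupation_subMode_eq_cohSum`).

References: E. H. Lieb, R. Seiringer, J. P. Solovej, J. Yngvason, *The Mathematics of the Bose Gas
and its Condensation* (2005), Lemma 4.1, Lemma 5.2, Thm. 5.1 (5.15)–(5.17), Thm. 2.2, Thm. 2.4;
E. H. Lieb, R. Seiringer, Phys. Rev. Lett. 88 (2002) 170409.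
-/

noncomputable section

open MeasureTheory Filter Set
open scoped ENNReal NNReal Topology BigOperators

namespace Summit.AtomisticToContinuum.BoseEinsteinCondensation.Cruxes.TangentTransfer.Birth

open Literature.MathematicalPhysics.QuantumManyBody.BoseGas

/-- **STUB 1 — the pinned mesoscopic floor** (registered signature of the line `registered` of
the crux `TangentTransfer`).  For every repulsive finite-range `v` and every `M ≥ 1` there is
`ρ₀ > 0` such that for `0 < ρ < ρ₀` some `N`-independent scale `ℓ ≥ M/√ρ` (namely `ℓ = M/√ρ`)
carries the floor: eventually in `N` there is `δ > 0` (namely `δ = 1`) such that for every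
`δ`-near-minimiser `Ψ` of the Dirichlet energy in the box of side `L = (N/ρ)^{1/3}` and every
dyadic level `k` with `ℓ ≤ L/2^k < 2ℓ`, `7N/8 ≤ cohSum N L k Ψ.ψ`.  Cases on the scattering length:
`floor_of_scatteringLength_zero` / `floor_of_scatteringLength_pos`, then
`sum_occupation_subMode_eq_cohSum`. [folklore] -/
theorem stub_mesoscopicFloorPinned :
    ∀ v : ℝ → ℝ≥0∞, IsRepulsiveFiniteRange v → ∀ M : ℝ, 1 ≤ M →
      ∃ ρ₀ : ℝ, 0 < ρ₀ ∧ ∀ ρ : ℝ, 0 < ρ → ρ < ρ₀ → ∃ ℓ : ℝ, M / Real.sqrt ρ ≤ ℓ ∧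
        ∀ᶠ N : ℕ in atTop, ∃ δ : ℝ≥0∞, 0 < δ ∧ ∀ Ψ : TrialState N (sideLength ρ N),
          energy v Ψ ≤ groundStateEnergy v N (sideLength ρ N) + δ →
          ∀ k : ℕ, ℓ ≤ sideLength ρ N / 2 ^ k → sideLength ρ N / 2 ^ k < 2 * ℓ →
            ENNReal.ofReal (7 * (N : ℝ) / 8) ≤ cohSum N (sideLength ρ N) k Ψ.ψ := by
  intro v hv M hM
  have hMpos : 0 < M := by linarith
  rcases eq_or_ne (scatteringLength v) 0 with h0 | hne
  · obtain ⟨ρ₀, hρ₀, H⟩ := floor_of_scatteringLength_zero hv h0 hMpos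
    refine ⟨ρ₀, hρ₀, fun ρ hρ hρlt => ⟨M / Real.sqrt ρ, le_rfl, ?_⟩⟩
    filter_upwards [H ρ hρ hρlt] with N hN
    refine ⟨1, one_pos, fun Ψ hΨ k hk1 hk2 => ?_⟩
    rw [← sum_occupation_subMode_eq_cohSum]
    exact hN Ψ hΨ k hk1 hk2
  · obtain ⟨ρ₀, hρ₀, H⟩ := floor_of_scatteringLength_pos hv (pos_iff_ne_zero.2 hne) hMpos
    refine ⟨ρ₀, hρ₀, fun ρ hρ hρlt => ⟨M / Real.sqrt ρ, le_rfl, ?_⟩⟩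
    filter_upwards [H ρ hρ hρlt] with N hN
    refine ⟨1, one_pos, fun Ψ hΨ k hk1 hk2 => ?_⟩
    rw [← sum_occupation_subMode_eq_cohSum]
    exact hN Ψ hΨ k hk1 hk2

end Summit.AtomisticToContinuum.BoseEinsteinCondensation.Cruxes.TangentTransfer.Birth

end
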